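import Literature.AlgebraicGeometry.Motives.AbelianVarietyWeights
import Mathlib.Algebra.Polynomial.Roots
import HarnessLib

/-!
# Crux `HeckePrymAnchors` (stmt-HodgeConjecture-14496), line `Sketch` · stub A1, part 1: polynomial families of classes

Route `HeckePrymWeil`, stub `stub_pointClassAnchor` (Deligne's split anchor, LNM 900 Lemma 4.5 /
Remark 4.10: the strong Weil plane of `(A₀ × A₀, companion)` is algebraic). Pure algebra used by
the proof: vector-valued POLYNOMIAL FUNCTIONS on `ℕ` and on `ℕ × ℕ`, written without new
definitions as `F n = ω.sum (fun e v ↦ (n : ℂ) ^ e • v)` for a finitely supported family of vector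
coefficients `ω : ℕ →₀ V` (resp. `r : ℕ × ℕ →₀ V` in two variables), and their closure properties:
constants, sums, scalar multiples, linear images, discrete antiderivatives `n ↦ Σ_{m<n} F m`
(Faulhaber, via the tree's `WeilCohomology.exists_sum_range_pow_eq`), solutions of
`G (n+1) = G n + D n`, and bilinear pairings of a polynomial in `u` with a polynomial in `w`.

The last lemma `pca_endgame` is the scalar contradiction at the heart of the anchor: no polynomial
function `q` on `ℕ × ℕ` satisfies `q(y, 0) = (1 + yθ)^m` and `q(a, 1 + p a²) = 0` when
`θ² = -p ≠ 0` — the two polynomial identities extend to `ℂ`, and at the complex point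
`y₀ = θ⁻¹` one has `1 + p y₀² = 0` but `(1 + y₀ θ)^m = 2^m ≠ 0`. (Geometrically: `𝟙 + θ⁻¹ ψ` is a
rank-one endomorphism of `A₀ × A₀` over `ℂ`, the projector onto one eigenspace of `ψ`.)
-/

noncomputable section
-- every declaration of this problem lives in Summit.HodgeConjecture.HodgeConjecture.… (summit = sub-problem)
set_option linter.dupNamespace false

namespace Summit.HodgeConjecture.HodgeConjecture.Theorems.HeckePrymWeilLine

open Polynomial

variable {V W V₁ V₂ V₃ : Type*} [AddCommGroup V] [Module ℂ V] [AddCommGroup W] [Module ℂ W]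
  [AddCommGroup V₁] [Module ℂ V₁] [AddCommGroup V₂] [Module ℂ V₂] [AddCommGroup V₃] [Module ℂ V₃]

/-! ## Polynomial functions `ℕ → V` -/

/-- A constant function is polynomial. [folklore] -/
theorem pca_poly_const (v : V) :
    ∃ ω : ℕ →₀ V, ∀ n : ℕ, v = ω.sum (fun e x ↦ ((n : ℂ) ^ e) • x) :=
  ⟨Finsupp.single 0 v, fun n ↦ by rw [Finsupp.sum_single_index (by simp), pow_zero, one_smul]⟩

/-- Sums of polynomial functions are polynomial. [folklore] -/
theorem pca_poly_add {F G : ℕ → V}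
    (hF : ∃ ω : ℕ →₀ V, ∀ n : ℕ, F n = ω.sum (fun e x ↦ ((n : ℂ) ^ e) • x))
    (hG : ∃ ω : ℕ →₀ V, ∀ n : ℕ, G n = ω.sum (fun e x ↦ ((n : ℂ) ^ e) • x)) :
    ∃ ω : ℕ →₀ V, ∀ n : ℕ, F n + G n = ω.sum (fun e x ↦ ((n : ℂ) ^ e) • x) := by
  obtain ⟨ω₁, h₁⟩ := hF
  obtain ⟨ω₂, h₂⟩ := hG
  refine ⟨ω₁ + ω₂, fun n ↦ ?_⟩
  rw [h₁ n, h₂ n, Finsupp.sum_add_index' (fun _ ↦ smul_zero _) (fun _ _ _ ↦ smul_add _ _ _)]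

/-- Scalar multiples of polynomial functions are polynomial. [folklore] -/
theorem pca_poly_smul (c : ℂ) {F : ℕ → V}
    (hF : ∃ ω : ℕ →₀ V, ∀ n : ℕ, F n = ω.sum (fun e x ↦ ((n : ℂ) ^ e) • x)) :
    ∃ ω : ℕ →₀ V, ∀ n : ℕ, c • F n = ω.sum (fun e x ↦ ((n : ℂ) ^ e) • x) := by
  obtain ⟨ω, h⟩ := hF
  refine ⟨c • ω, fun n ↦ ?_⟩
  rw [h n, Finsupp.sum_smul_index' (fun _ ↦ smul_zero _), Finsupp.smul_sum]
  exact Finsupp.sum_congr fun e _ ↦ (smul_comm _ _ _)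

/-- Finite sums of polynomial functions are polynomial. [folklore] -/
theorem pca_poly_sum {ι : Type*} (s : Finset ι) (F : ι → ℕ → V)
    (hF : ∀ i ∈ s, ∃ ω : ℕ →₀ V, ∀ n : ℕ, F i n = ω.sum (fun e x ↦ ((n : ℂ) ^ e) • x)) :
    ∃ ω : ℕ →₀ V, ∀ n : ℕ, (∑ i ∈ s, F i n) = ω.sum (fun e x ↦ ((n : ℂ) ^ e) • x) := by
  classical
  induction s using Finset.induction_on with
  | empty => exact ⟨0, fun n ↦ by rw [Finset.sum_empty, Finsupp.sum_zero_index]⟩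
  | insert i s hi ih =>
    obtain ⟨ω, hω⟩ := pca_poly_add (hF i (Finset.mem_insert_self i s))
      (ih fun j hj ↦ hF j (Finset.mem_insert_of_mem hj))
    exact ⟨ω, fun n ↦ by rw [Finset.sum_insert hi, hω n]⟩

/-- Linear images of polynomial functions are polynomial. [folklore] -/
theorem pca_poly_map (L : V →ₗ[ℂ] W) {F : ℕ → V}
    (hF : ∃ ω : ℕ →₀ V, ∀ n : ℕ, F n = ω.sum (fun e x ↦ ((n : ℂ) ^ e) • x)) :
    ∃ ω : ℕ →₀ W, ∀ n : ℕ, L (F n) = ω.sum (fun e x ↦ ((n : ℂ) ^ e) • x) := by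
  obtain ⟨ω, h⟩ := hF
  refine ⟨ω.mapRange L L.map_zero, fun n ↦ ?_⟩
  rw [h n, map_finsuppSum, Finsupp.sum_mapRange_index (fun _ ↦ smul_zero _)]
  exact Finsupp.sum_congr fun e _ ↦ (L.map_smul _ _)

/-- **Discrete antiderivatives of polynomial functions are polynomial** (Faulhaber: `Σ_{m<n} mᵉ` is
a polynomial in `n`). [folklore] -/
theorem pca_poly_antideriv {F : ℕ → V}
    (hF : ∃ ω : ℕ →₀ V, ∀ n : ℕ, F n = ω.sum (fun e x ↦ ((n : ℂ) ^ e) • x)) :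
    ∃ ω : ℕ →₀ V, ∀ n : ℕ, (∑ m ∈ Finset.range n, F m) = ω.sum (fun e x ↦ ((n : ℂ) ^ e) • x) := by
  classical
  obtain ⟨ω, h⟩ := hF
  have hfaul : ∀ e : ℕ, ∃ c : ℕ → ℂ, ∀ n : ℕ, (∑ m ∈ Finset.range n, (m : ℂ) ^ e) =
      ∑ i ∈ Finset.range (e + 2), c i * (n : ℂ) ^ i := fun e ↦
    Literature.AlgebraicGeometry.Motives.WeilCohomology.exists_sum_range_pow_eq (K := ℂ) e (e + 1)
      (Nat.lt_succ_self e)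
  choose c hc using hfaul
  refine ⟨ω.sum (fun e x ↦ ∑ i ∈ Finset.range (e + 2), Finsupp.single i (c e i • x)), fun n ↦ ?_⟩
  have hcomm : (∑ m ∈ Finset.range n, F m) =
      ω.sum (fun e x ↦ (∑ m ∈ Finset.range n, (m : ℂ) ^ e) • x) := by
    simp_rw [h, Finsupp.sum, Finset.sum_smul]
    exact Finset.sum_comm
  rw [hcomm, Finsupp.sum_sum_index (fun _ ↦ smul_zero _) (fun _ _ _ ↦ smul_add _ _ _)]
  refine Finsupp.sum_congr fun e _ ↦ ?_
  rw [hc e n, Finset.sum_smul,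
    ← Finsupp.sum_finsetSum_index (fun _ ↦ smul_zero _) (fun _ _ _ ↦ smul_add _ _ _)]
  refine Finset.sum_congr rfl fun i _ ↦ ?_
  rw [Finsupp.sum_single_index (by simp), smul_smul, mul_comm]

/-- A solution of the recursion `G (n + 1) = G n + D n` with `D` polynomial is polynomial.
[folklore] -/
theorem pca_poly_of_succ {G D : ℕ → V} (hG : ∀ n : ℕ, G (n + 1) = G n + D n)
    (hD : ∃ ω : ℕ →₀ V, ∀ n : ℕ, D n = ω.sum (fun e x ↦ ((n : ℂ) ^ e) • x)) :
    ∃ ω : ℕ →₀ V, ∀ n : ℕ, G n = ω.sum (fun e x ↦ ((n : ℂ) ^ e) • x) := by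
  have htel : ∀ n : ℕ, G n = G 0 + ∑ m ∈ Finset.range n, D m := by
    intro n
    induction n with
    | zero => rw [Finset.sum_range_zero, add_zero]
    | succ n ih => rw [hG n, ih, Finset.sum_range_succ, add_assoc]
  obtain ⟨ω, hω⟩ := pca_poly_add (pca_poly_const (G 0)) (pca_poly_antideriv hD)
  exact ⟨ω, fun n ↦ by rw [htel n, hω n]⟩

/-! ## Polynomial functions `ℕ → ℕ → V` -/

/-- **A bilinear pairing of a polynomial in `u` with a polynomial in `w` is a polynomial in
`(u, w)`.** [folklore] -/
theorem pca_poly₂_bilin (Φ : V₁ →ₗ[ℂ] V₂ →ₗ[ℂ] V₃) {F : ℕ → V₁} {G : ℕ → V₂}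
    (hF : ∃ ω : ℕ →₀ V₁, ∀ n : ℕ, F n = ω.sum (fun e x ↦ ((n : ℂ) ^ e) • x))
    (hG : ∃ ω : ℕ →₀ V₂, ∀ n : ℕ, G n = ω.sum (fun e x ↦ ((n : ℂ) ^ e) • x)) :
    ∃ r : (ℕ × ℕ) →₀ V₃, ∀ u w : ℕ,
      Φ (F u) (G w) = r.sum (fun x v ↦ (((u : ℂ) ^ x.1) * ((w : ℂ) ^ x.2)) • v) := by
  obtain ⟨ω₁, h₁⟩ := hF
  obtain ⟨ω₂, h₂⟩ := hG
  refine ⟨ω₁.sum (fun e x ↦ ω₂.sum (fun e' y ↦ Finsupp.single (e, e') (Φ x y))), fun u w ↦ ?_⟩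
  rw [h₁ u, h₂ w, Finsupp.sum_sum_index (fun _ ↦ smul_zero _) (fun _ _ _ ↦ smul_add _ _ _)]
  have inner : ∀ (e : ℕ) (x : V₁),
      (ω₂.sum fun e' y ↦ Finsupp.single (e, e') (Φ x y)).sum
          (fun x v ↦ (((u : ℂ) ^ x.1) * ((w : ℂ) ^ x.2)) • v) =
        ω₂.sum fun e' y ↦ (((u : ℂ) ^ e) * ((w : ℂ) ^ e')) • Φ x y := by
    intro e x
    rw [Finsupp.sum_sum_index (fun _ ↦ smul_zero _) (fun _ _ _ ↦ smul_add _ _ _)]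
    exact Finsupp.sum_congr fun e' _ ↦ Finsupp.sum_single_index (by simp)
  simp_rw [inner]
  simp only [Finsupp.sum, map_sum, LinearMap.sum_apply, map_smul, LinearMap.smul_apply, mul_smul,
    Finset.smul_sum]
  rw [Finset.sum_comm]
  exact Finset.sum_congr rfl fun e _ ↦ Finset.sum_congr rfl fun e' _ ↦ smul_comm _ _ _

/-- Sums of polynomial functions of two variables are polynomial. [folklore] -/
theorem pca_poly₂_add {F G : ℕ → ℕ → V}
    (hF : ∃ r : (ℕ × ℕ) →₀ V, ∀ u w : ℕ, F u w = r.sum (fun x v ↦ (((u : ℂ) ^ x.1) * ((w : ℂ) ^ x.2)) • v))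
    (hG : ∃ r : (ℕ × ℕ) →₀ V, ∀ u w : ℕ, G u w = r.sum (fun x v ↦ (((u : ℂ) ^ x.1) * ((w : ℂ) ^ x.2)) • v)) :
    ∃ r : (ℕ × ℕ) →₀ V, ∀ u w : ℕ,
      F u w + G u w = r.sum (fun x v ↦ (((u : ℂ) ^ x.1) * ((w : ℂ) ^ x.2)) • v) := by
  obtain ⟨r₁, h₁⟩ := hF
  obtain ⟨r₂, h₂⟩ := hG
  refine ⟨r₁ + r₂, fun u w ↦ ?_⟩
  rw [h₁ u w, h₂ u w, Finsupp.sum_add_index' (fun _ ↦ smul_zero _) (fun _ _ _ ↦ smul_add _ _ _)]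

/-- Finite sums of polynomial functions of two variables are polynomial. [folklore] -/
theorem pca_poly₂_sum {ι : Type*} (s : Finset ι) (F : ι → ℕ → ℕ → V)
    (hF : ∀ i ∈ s, ∃ r : (ℕ × ℕ) →₀ V, ∀ u w : ℕ,
      F i u w = r.sum (fun x v ↦ (((u : ℂ) ^ x.1) * ((w : ℂ) ^ x.2)) • v)) :
    ∃ r : (ℕ × ℕ) →₀ V, ∀ u w : ℕ,
      (∑ i ∈ s, F i u w) = r.sum (fun x v ↦ (((u : ℂ) ^ x.1) * ((w : ℂ) ^ x.2)) • v) := by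
  classical
  induction s using Finset.induction_on with
  | empty => exact ⟨0, fun u w ↦ by rw [Finset.sum_empty, Finsupp.sum_zero_index]⟩
  | insert i s hi ih =>
    obtain ⟨r, hr⟩ := pca_poly₂_add (hF i (Finset.mem_insert_self i s))
      (ih fun j hj ↦ hF j (Finset.mem_insert_of_mem hj))
    exact ⟨r, fun u w ↦ by rw [Finset.sum_insert hi, hr u w]⟩

/-- Linear images of polynomial functions of two variables are polynomial. [folklore] -/
theorem pca_poly₂_map (L : V →ₗ[ℂ] W) {F : ℕ → ℕ → V}
    (hF : ∃ r : (ℕ × ℕ) →₀ V, ∀ u w : ℕ, F u w = r.sum (fun x v ↦ (((u : ℂ) ^ x.1) * ((w : ℂ) ^ x.2)) • v)) :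
    ∃ r : (ℕ × ℕ) →₀ W, ∀ u w : ℕ,
      L (F u w) = r.sum (fun x v ↦ (((u : ℂ) ^ x.1) * ((w : ℂ) ^ x.2)) • v) := by
  obtain ⟨r, h⟩ := hF
  refine ⟨r.mapRange L L.map_zero, fun u w ↦ ?_⟩
  rw [h u w, map_finsuppSum, Finsupp.sum_mapRange_index (fun _ ↦ smul_zero _)]
  exact Finsupp.sum_congr fun e _ ↦ (L.map_smul _ _)

/-! ## The scalar contradiction -/

/-- **The endgame of the split anchor.** If `θ² = -p ≠ 0`, no polynomial function `q` on `ℕ × ℕ`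
has `q(y, 0) = (1 + yθ)^m` for all `y` and `q(a, 1 + p a²) = 0` for all `a`: both identities are
polynomial identities in one variable, hence hold at the complex point `y₀ = θ⁻¹`, where
`1 + p y₀² = 0` makes them evaluate the same expression, to `2^m` and to `0` respectively.
[folklore] -/
theorem pca_endgame {p : ℕ} (hp : p ≠ 0) {θ : ℂ} (hθ : θ ^ 2 = -(p : ℂ)) (m : ℕ) (q : ℕ → ℕ → ℂ)
    (hq : ∃ r : (ℕ × ℕ) →₀ ℂ, ∀ u w : ℕ, q u w = r.sum (fun x v ↦ (((u : ℂ) ^ x.1) * ((w : ℂ) ^ x.2)) • v))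
    (h1 : ∀ y : ℕ, q y 0 = (1 + (y : ℂ) * θ) ^ m) (h2 : ∀ a : ℕ, q a (1 + p * a ^ 2) = 0) :
    False := by
  obtain ⟨r, hr⟩ := hq
  have hpC : (p : ℂ) ≠ 0 := Nat.cast_ne_zero.mpr hp
  have hθ0 : θ ≠ 0 := by
    rintro rfl
    rw [zero_pow two_ne_zero, zero_eq_neg] at hθ
    exact hpC hθ
  -- the two one-variable polynomials
  let R₁ : ℂ[X] := r.sum (fun x v ↦ C (v * 0 ^ x.2) * X ^ x.1)
  let R₂ : ℂ[X] := r.sum (fun x v ↦ C v * X ^ x.1 * (1 + C (p : ℂ) * X ^ 2) ^ x.2)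
  have hR₁ : ∀ z : ℂ, R₁.eval z = r.sum (fun x v ↦ ((z ^ x.1) * (0 ^ x.2)) • v) := by
    intro z
    simp only [R₁, Finsupp.sum, eval_finsetSum, eval_mul, eval_C, eval_pow, eval_X, smul_eq_mul]
    exact Finset.sum_congr rfl fun x _ ↦ by ring
  have hR₂ : ∀ z : ℂ, R₂.eval z =
      r.sum (fun x v ↦ ((z ^ x.1) * ((1 + (p : ℂ) * z ^ 2) ^ x.2)) • v) := by
    intro z
    simp only [R₂, Finsupp.sum, eval_finsetSum, eval_mul, eval_C, eval_pow, eval_X, eval_add,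
      eval_one, smul_eq_mul]
    exact Finset.sum_congr rfl fun x _ ↦ by ring
  -- `R₂ = 0`: it vanishes on `ℕ`
  have hR₂0 : R₂ = 0 := by
    apply Polynomial.eq_zero_of_infinite_isRoot
    refine Set.Infinite.mono ?_ (Set.infinite_range_of_injective Nat.cast_injective)
    rintro _ ⟨a, rfl⟩
    rw [Set.mem_setOf_eq, IsRoot.def, hR₂, ← h2 a, hr]
    push_cast
    rfl
  -- `R₁ = (1 + θ X)^m`: they agree on `ℕ`
  have hR₁1 : R₁ = (1 + C θ * X) ^ m := by
    apply Polynomial.eq_of_infinite_eval_eq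
    refine Set.Infinite.mono ?_ (Set.infinite_range_of_injective Nat.cast_injective)
    rintro _ ⟨y, rfl⟩
    rw [Set.mem_setOf_eq, hR₁, eval_pow, eval_add, eval_one, eval_mul, eval_C, eval_X, mul_comm θ,
      ← h1 y, hr]
    push_cast
    rfl
  -- evaluate both at `y₀ = θ⁻¹`, where `1 + p y₀² = 0`
  have hy₀ : 1 + (p : ℂ) * θ⁻¹ ^ 2 = 0 := by
    rw [inv_pow, hθ, inv_neg, mul_neg, mul_inv_cancel₀ hpC, add_neg_cancel]
  have hev : R₂.eval θ⁻¹ = R₁.eval θ⁻¹ := by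
    rw [hR₁, hR₂, hy₀]
  rw [hR₂0, eval_zero, hR₁1, eval_pow, eval_add, eval_one, eval_mul, eval_C, eval_X,
    mul_inv_cancel₀ hθ0] at hev
  norm_num at hev
  exact absurd hev.symm (pow_ne_zero m two_ne_zero)

/-- **Registered sub-goal form of `pca_endgame`** (stub `pca_stub_endgame` of crux
`HeckePrymAnchors`, serving `stub_pointClassAnchor`): the scalar contradiction, fully quantified.
[folklore] -/
theorem pca_stub_endgame :
    ∀ (p : ℕ), p ≠ 0 → ∀ (θ : ℂ), θ ^ 2 = -(p : ℂ) → ∀ (m : ℕ) (q : ℕ → ℕ → ℂ),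
      (∃ r : (ℕ × ℕ) →₀ ℂ, ∀ u w : ℕ, q u w = r.sum (fun x v ↦ ((u : ℂ) ^ x.1 * (w : ℂ) ^ x.2) • v)) →
      (∀ y : ℕ, q y 0 = (1 + (y : ℂ) * θ) ^ m) → (∀ a : ℕ, q a (1 + p * a ^ 2) = 0) → False :=
  fun _ hp _ hθ m q hq h1 h2 ↦ pca_endgame hp hθ m q hq h1 h2

end Summit.HodgeConjecture.HodgeConjecture.Theorems.HeckePrymWeilLine

end
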